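import Mathlib.Analysis.Complex.Basic
import Mathlib.FieldTheory.IntermediateField.Adjoin.Basic
import Mathlib.RingTheory.IntegralClosure.IsIntegralClosure.Basic
import HarnessLib

/-!
# CM biquadratic extensions of a real field inside `ℂ`: the subfield lattice by eigenvectors of complex conjugation

COR-CM (cell `pub-hodgecm2`, binder seat `b16` gen 50, count-neutral claim CM44-COMMONQUARTIC, file F1; theorems only,
no definition, no named fact, no `sorry`).  Pure algebra in `ℂ` ([folklore]); NEW as packaged, the ENGINE of the
`(4,4)` cell over a common quartic CM subfield (reflex fields `k⁺(√Δ₁, √(Δ₂d₂))` of one-unsplit-pair octic types).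

DATA.  `F ≤ ℂ` a subfield fixed pointwise by complex conjugation (`F ⊂ ℝ`), and `α, β ∈ ℂ` ANTI-REAL (`ᾱ = −α`,
`β̄ = −β`) with `α², β² ∈ F` and `αβ ∉ F`.  Then (§1) `1, α, β, αβ` are `F`-linearly independent
(`repr_eq_zero`: apply conjugation and compare), (§2) `E = F ⊕ Fα ⊕ Fβ ⊕ Fαβ` is a subfield of `ℂ` — it is the
intermediate field `F ⊔ ℚ⟮α, β⟯` (`mem_sup_adjoin_iff`; the inverse of `t = a + bα + cβ + dαβ` is
`t₁ (P − Qβ)/N` with `t₁ = a − bα + cβ − dαβ`, `t t₁ = P + Qβ`, `N = P² − Q²β²`), stable under conjugation, whose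
ANTI-REAL elements are exactly `Fα ⊕ Fβ` (`exists_repr_of_conj_eq_neg`), (§3) an anti-real `pα + qβ` has its square
in `F` only if `pq = 0` (`eq_zero_or_eq_zero_of_sq_mem`), and a subfield `M ⊇ F` containing `pα + qβ` with `pq ≠ 0`
contains `α` and `β` (`mem_of_combination_mem`).  CONSEQUENCE (§4, **`conj_apply_eq_of_mem_of_mem`**): two such
fields `E₀ = F(α, β)`, `E₁ = F(α′, β′)` over the same `F` MEET IN A FIELD FIXED POINTWISE BY CONJUGATION unless one
of `α/α′, α/β′, β/α′, β/β′` lies in `F` — the three quadratic subfields of the biquadratic `E₀/F` are `F(α)`, `F(β)`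
(CM) and `F(αβ)` (real), so a non-real common subfield forces a coincidence of CM quadratic subfields.  No Galois
correspondence is used.  §5: `E` is finite over `ℚ` when `F` is.

Consumers: `CorCM/CommonQuarticCMSubfieldReflexCoincidences` (the hypothesis `hreal` of the tree's
`ReflexFieldsMeetRealCMHodge.hodgeConjectureFor_prod_of_fixingFields_inf_real`).

## References

* [Lang2002] S. Lang, *Algebra*, 3rd ed., VI §1 (biquadratic extensions), V §1.
* [Shimura1998] G. Shimura, *Abelian Varieties with Complex Multiplication and Modular Functions*, §8.4 (2)(C), §18.1
  (CM fields as `K₀(√−δ)`).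
-/

set_option autoImplicit false

noncomputable section

open scoped ComplexConjugate

namespace Summit.HodgeConjecture.CorCM.CMBiquad

variable {F : IntermediateField ℚ ℂ} {α β : ℂ}

/-! ### §1 Independence of `1, α, β, αβ` over `F` -/

/-- `αβ ∉ F` forces `α ≠ 0`. [folklore] -/
theorem left_ne_zero (hind : α * β ∉ F) : α ≠ 0 := fun h => hind (by rw [h, zero_mul]; exact zero_mem F)

/-- `αβ ∉ F` forces `β ≠ 0`. [folklore] -/
theorem right_ne_zero (hind : α * β ∉ F) : β ≠ 0 := fun h => hind (by rw [h, mul_zero]; exact zero_mem F)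

/-- **Independence.**  For `F ⊂ ℝ`, `α, β` anti-real with `β² ∈ F` and `αβ ∉ F`: `a + bα + cβ + dαβ = 0` with
`a, b, c, d ∈ F` forces `a = b = c = d = 0` (conjugate and add/subtract: `a + dαβ = 0`, `bα + cβ = 0`). [folklore] -/
theorem repr_eq_zero (hF : ∀ t ∈ F, conj t = t) (hα : conj α = -α) (hβ : conj β = -β) (hB : β * β ∈ F)
    (hind : α * β ∉ F) {a b c d : ℂ} (ha : a ∈ F) (hb : b ∈ F) (hc : c ∈ F) (hd : d ∈ F)
    (h : a + b * α + c * β + d * (α * β) = 0) : a = 0 ∧ b = 0 ∧ c = 0 ∧ d = 0 := by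
  have hβ0 := right_ne_zero hind
  have h' : a - b * α - c * β + d * (α * β) = 0 := by
    have := congrArg conj h
    rw [map_add, map_add, map_add, map_mul, map_mul, map_mul, map_mul, hF a ha, hF b hb, hF c hc, hF d hd, hα, hβ,
      map_zero] at this
    linear_combination this
  have h1 : a + d * (α * β) = 0 := by linear_combination (h + h') / 2
  have h2 : b * α + c * β = 0 := by linear_combination (h - h') / 2
  have hd0 : d = 0 := by
    by_contra hd0
    apply hind
    have : α * β = -a * d⁻¹ := by field_simp; linear_combination h1
    rw [this]
    exact mul_mem (neg_mem ha) (inv_mem hd)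
  have ha0 : a = 0 := by rw [hd0, zero_mul, add_zero] at h1; exact h1
  have hb0 : b = 0 := by
    by_contra hb0
    apply hind
    have hα' : α = -c * b⁻¹ * β := by field_simp; linear_combination h2
    have : α * β = -c * b⁻¹ * (β * β) := by rw [hα']; ring
    rw [this]
    exact mul_mem (mul_mem (neg_mem hc) (inv_mem hb)) hB
  have hc0 : c = 0 := by
    rw [hb0, zero_mul, zero_add] at h2
    rcases mul_eq_zero.1 h2 with h | h
    · exact h
    · exact absurd h hβ0
  exact ⟨ha0, hb0, hc0, hd0⟩

/-- **Uniqueness of coordinates** in `F ⊕ Fα ⊕ Fβ ⊕ Fαβ`. [folklore] -/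
theorem repr_unique (hF : ∀ t ∈ F, conj t = t) (hα : conj α = -α) (hβ : conj β = -β) (hB : β * β ∈ F)
    (hind : α * β ∉ F) {a b c d a' b' c' d' : ℂ} (ha : a ∈ F) (hb : b ∈ F) (hc : c ∈ F) (hd : d ∈ F) (ha' : a' ∈ F)
    (hb' : b' ∈ F) (hc' : c' ∈ F) (hd' : d' ∈ F)
    (h : a + b * α + c * β + d * (α * β) = a' + b' * α + c' * β + d' * (α * β)) :
    a = a' ∧ b = b' ∧ c = c' ∧ d = d' := by
  have h0 : (a - a') + (b - b') * α + (c - c') * β + (d - d') * (α * β) = 0 := by linear_combination h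
  obtain ⟨h1, h2, h3, h4⟩ := repr_eq_zero hF hα hβ hB hind (sub_mem ha ha') (sub_mem hb hb') (sub_mem hc hc')
    (sub_mem hd hd') h0
  exact ⟨sub_eq_zero.1 h1, sub_eq_zero.1 h2, sub_eq_zero.1 h3, sub_eq_zero.1 h4⟩

/-! ### §2 The field `E = F ⊕ Fα ⊕ Fβ ⊕ Fαβ = F ⊔ ℚ⟮α, β⟯` -/

/-- **`F ⊕ Fα ⊕ Fβ ⊕ Fαβ` is a subfield of `ℂ`** (closed under products by `α², β² ∈ F`; inverses by the norm to
`F(β)` and then to `F`). [folklore] -/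
theorem exists_intermediateField_mem_iff (hF : ∀ t ∈ F, conj t = t) (hα : conj α = -α) (hβ : conj β = -β)
    (hA : α * α ∈ F) (hB : β * β ∈ F) (hind : α * β ∉ F) :
    ∃ S : IntermediateField ℚ ℂ, ∀ t : ℂ,
      t ∈ S ↔ ∃ a b c d : ℂ, a ∈ F ∧ b ∈ F ∧ c ∈ F ∧ d ∈ F ∧ t = a + b * α + c * β + d * (α * β) := by
  -- closure under multiplication, as a reusable statement
  have hmul : ∀ t t' : ℂ,
      (∃ a b c d : ℂ, a ∈ F ∧ b ∈ F ∧ c ∈ F ∧ d ∈ F ∧ t = a + b * α + c * β + d * (α * β)) →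
      (∃ a b c d : ℂ, a ∈ F ∧ b ∈ F ∧ c ∈ F ∧ d ∈ F ∧ t' = a + b * α + c * β + d * (α * β)) →
      ∃ a b c d : ℂ, a ∈ F ∧ b ∈ F ∧ c ∈ F ∧ d ∈ F ∧ t * t' = a + b * α + c * β + d * (α * β) := by
    rintro t t' ⟨a, b, c, d, ha, hb, hc, hd, rfl⟩ ⟨a', b', c', d', ha', hb', hc', hd', rfl⟩
    refine ⟨a * a' + b * b' * (α * α) + c * c' * (β * β) + d * d' * (α * α) * (β * β),
      a * b' + b * a' + (c * d' + d * c') * (β * β), a * c' + c * a' + (b * d' + d * b') * (α * α),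
      a * d' + d * a' + b * c' + c * b', ?_, ?_, ?_, ?_, by ring⟩
    · exact add_mem (add_mem (add_mem (mul_mem ha ha') (mul_mem (mul_mem hb hb') hA))
        (mul_mem (mul_mem hc hc') hB)) (mul_mem (mul_mem (mul_mem hd hd') hA) hB)
    · exact add_mem (add_mem (mul_mem ha hb') (mul_mem hb ha')) (mul_mem (add_mem (mul_mem hc hd') (mul_mem hd hc')) hB)
    · exact add_mem (add_mem (mul_mem ha hc') (mul_mem hc ha')) (mul_mem (add_mem (mul_mem hb hd') (mul_mem hd hb')) hA)
    · exact add_mem (add_mem (add_mem (mul_mem ha hd') (mul_mem hd ha')) (mul_mem hb hc')) (mul_mem hc hb')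
  have hofF : ∀ t : ℂ, t ∈ F →
      ∃ a b c d : ℂ, a ∈ F ∧ b ∈ F ∧ c ∈ F ∧ d ∈ F ∧ t = a + b * α + c * β + d * (α * β) := fun t ht =>
    ⟨t, 0, 0, 0, ht, zero_mem F, zero_mem F, zero_mem F, by ring⟩
  refine ⟨{ carrier := {t | ∃ a b c d : ℂ, a ∈ F ∧ b ∈ F ∧ c ∈ F ∧ d ∈ F ∧ t = a + b * α + c * β + d * (α * β)}
            mul_mem' := fun {t t'} ht ht' => hmul t t' ht ht'
            one_mem' := hofF 1 (one_mem F)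
            add_mem' := ?_
            zero_mem' := hofF 0 (zero_mem F)
            algebraMap_mem' := fun q => hofF _ (F.algebraMap_mem q)
            inv_mem' := ?_ }, fun t => Iff.rfl⟩
  · rintro t t' ⟨a, b, c, d, ha, hb, hc, hd, rfl⟩ ⟨a', b', c', d', ha', hb', hc', hd', rfl⟩
    exact ⟨a + a', b + b', c + c', d + d', add_mem ha ha', add_mem hb hb', add_mem hc hc', add_mem hd hd', by ring⟩
  · rintro t ⟨a, b, c, d, ha, hb, hc, hd, rfl⟩
    by_cases ht : a + b * α + c * β + d * (α * β) = 0
    · rw [ht, inv_zero]; exact hofF 0 (zero_mem F)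
    -- `t₁ = a − bα + cβ − dαβ`, `t t₁ = P + Qβ`, `N = P² − Q²β² = t t₁ (P − Qβ)`
    set P : ℂ := a * a + c * c * (β * β) - (b * b + d * d * (β * β)) * (α * α) with hP
    set Q : ℂ := 2 * a * c - 2 * b * d * (α * α) with hQ
    have hPF : P ∈ F := sub_mem (add_mem (mul_mem ha ha) (mul_mem (mul_mem hc hc) hB))
      (mul_mem (add_mem (mul_mem hb hb) (mul_mem (mul_mem hd hd) hB)) hA)
    have hQF : Q ∈ F := sub_mem (mul_mem (mul_mem (natCast_mem F 2) ha) hc)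
      (mul_mem (mul_mem (mul_mem (natCast_mem F 2) hb) hd) hA)
    have ht₁ : a - b * α + c * β - d * (α * β) ≠ 0 := by
      intro h0
      have h0' : a + (-b) * α + c * β + (-d) * (α * β) = 0 := by linear_combination h0
      obtain ⟨h1, h2, h3, h4⟩ := repr_eq_zero hF hα hβ hB hind ha (neg_mem hb) hc (neg_mem hd) h0'
      apply ht
      rw [h1, neg_eq_zero.1 h2, h3, neg_eq_zero.1 h4]; ring
    have hprod : (a + b * α + c * β + d * (α * β)) * (a - b * α + c * β - d * (α * β)) = P + Q * β := by
      rw [hP, hQ]; ring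
    have hPQ : P - Q * β ≠ 0 := by
      intro h0
      have h0' : P + 0 * α + (-Q) * β + 0 * (α * β) = 0 := by linear_combination h0
      obtain ⟨h1, -, h3, -⟩ := repr_eq_zero hF hα hβ hB hind hPF (zero_mem F) (neg_mem hQF) (zero_mem F) h0'
      have : P + Q * β = 0 := by rw [h1, neg_eq_zero.1 h3]; ring
      rw [this] at hprod
      rcases mul_eq_zero.1 hprod with h | h
      · exact ht h
      · exact ht₁ h
    have hN : P * P - Q * Q * (β * β) ≠ 0 := by
      have : P * P - Q * Q * (β * β) = (P + Q * β) * (P - Q * β) := by ring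
      rw [this, ← hprod]
      exact mul_ne_zero (mul_ne_zero ht ht₁) hPQ
    have hNF : P * P - Q * Q * (β * β) ∈ F := sub_mem (mul_mem hPF hPF) (mul_mem (mul_mem hQF hQF) hB)
    have hinv : (a + b * α + c * β + d * (α * β))⁻¹ =
        (P * P - Q * Q * (β * β))⁻¹ * ((a - b * α + c * β - d * (α * β)) * (P - Q * β)) := by
      refine inv_eq_of_mul_eq_one_right ?_
      have h1 : (a + b * α + c * β + d * (α * β)) * ((a - b * α + c * β - d * (α * β)) * (P - Q * β)) =
          P * P - Q * Q * (β * β) := by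
        rw [← mul_assoc, hprod]; ring
      rw [mul_left_comm, h1, inv_mul_cancel₀ hN]
    rw [hinv]
    refine hmul _ _ (hofF _ (inv_mem hNF)) (hmul _ _ ⟨a, -b, c, -d, ha, neg_mem hb, hc, neg_mem hd, by ring⟩
      ⟨P, 0, -Q, 0, hPF, zero_mem F, neg_mem hQF, zero_mem F, by ring⟩)

/-- **Membership in `E = F ⊔ ℚ⟮α, β⟯`**: `t ∈ E ⟺ t = a + bα + cβ + dαβ` with `a, b, c, d ∈ F`. [folklore] -/
theorem mem_sup_adjoin_iff (hF : ∀ t ∈ F, conj t = t) (hα : conj α = -α) (hβ : conj β = -β) (hA : α * α ∈ F)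
    (hB : β * β ∈ F) (hind : α * β ∉ F) (t : ℂ) :
    t ∈ F ⊔ IntermediateField.adjoin ℚ {α, β} ↔
      ∃ a b c d : ℂ, a ∈ F ∧ b ∈ F ∧ c ∈ F ∧ d ∈ F ∧ t = a + b * α + c * β + d * (α * β) := by
  obtain ⟨S, hS⟩ := exists_intermediateField_mem_iff hF hα hβ hA hB hind
  constructor
  · intro ht
    have hle : F ⊔ IntermediateField.adjoin ℚ {α, β} ≤ S := by
      refine sup_le (fun x hx => (hS x).2 ⟨x, 0, 0, 0, hx, zero_mem F, zero_mem F, zero_mem F, by ring⟩) ?_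
      rw [IntermediateField.adjoin_le_iff]
      intro x hx
      rcases hx with rfl | rfl
      · exact (hS _).2 ⟨0, 1, 0, 0, zero_mem F, one_mem F, zero_mem F, zero_mem F, by ring⟩
      · exact (hS _).2 ⟨0, 0, 1, 0, zero_mem F, zero_mem F, one_mem F, zero_mem F, by ring⟩
    exact (hS t).1 (hle ht)
  · rintro ⟨a, b, c, d, ha, hb, hc, hd, rfl⟩
    have hF' : ∀ x ∈ F, x ∈ F ⊔ IntermediateField.adjoin ℚ {α, β} := fun x hx =>
      (le_sup_left : F ≤ F ⊔ IntermediateField.adjoin ℚ {α, β}) hx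
    have hα' : α ∈ F ⊔ IntermediateField.adjoin ℚ {α, β} :=
      le_sup_right (a := F) (IntermediateField.subset_adjoin ℚ _ (Set.mem_insert α {β}))
    have hβ' : β ∈ F ⊔ IntermediateField.adjoin ℚ {α, β} :=
      le_sup_right (a := F) (IntermediateField.subset_adjoin ℚ _ (Set.mem_insert_of_mem α rfl))
    exact add_mem (add_mem (add_mem (hF' a ha) (mul_mem (hF' b hb) hα')) (mul_mem (hF' c hc) hβ'))
      (mul_mem (hF' d hd) (mul_mem hα' hβ'))

/-- `F ≤ E`. [folklore] -/
theorem le_sup_adjoin : F ≤ F ⊔ IntermediateField.adjoin ℚ {α, β} := le_sup_left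

/-- `α ∈ E`. [folklore] -/
theorem left_mem_sup_adjoin : α ∈ F ⊔ IntermediateField.adjoin ℚ {α, β} :=
  le_sup_right (a := F) (IntermediateField.subset_adjoin ℚ _ (Set.mem_insert α {β}))

/-- `β ∈ E`. [folklore] -/
theorem right_mem_sup_adjoin : β ∈ F ⊔ IntermediateField.adjoin ℚ {α, β} :=
  le_sup_right (a := F) (IntermediateField.subset_adjoin ℚ _ (Set.mem_insert_of_mem α rfl))

/-- **`E` is stable under complex conjugation** (`\overline{a + bα + cβ + dαβ} = a − bα − cβ + dαβ`). [folklore] -/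
theorem conj_mem_sup_adjoin (hF : ∀ t ∈ F, conj t = t) (hα : conj α = -α) (hβ : conj β = -β) (hA : α * α ∈ F)
    (hB : β * β ∈ F) (hind : α * β ∉ F) {t : ℂ} (ht : t ∈ F ⊔ IntermediateField.adjoin ℚ {α, β}) :
    conj t ∈ F ⊔ IntermediateField.adjoin ℚ {α, β} := by
  rw [mem_sup_adjoin_iff hF hα hβ hA hB hind] at ht ⊢
  obtain ⟨a, b, c, d, ha, hb, hc, hd, rfl⟩ := ht
  refine ⟨a, -b, -c, d, ha, neg_mem hb, neg_mem hc, hd, ?_⟩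
  rw [map_add, map_add, map_add, map_mul, map_mul, map_mul, map_mul, hF a ha, hF b hb, hF c hc, hF d hd, hα, hβ]
  ring

/-- **The anti-real elements of `E` are `Fα ⊕ Fβ`**: `t ∈ E`, `t̄ = −t` ⟹ `t = bα + cβ`. [folklore] -/
theorem exists_repr_of_conj_eq_neg (hF : ∀ t ∈ F, conj t = t) (hα : conj α = -α) (hβ : conj β = -β)
    (hA : α * α ∈ F) (hB : β * β ∈ F) (hind : α * β ∉ F) {t : ℂ} (ht : t ∈ F ⊔ IntermediateField.adjoin ℚ {α, β})
    (hct : conj t = -t) : ∃ b c : ℂ, b ∈ F ∧ c ∈ F ∧ t = b * α + c * β := by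
  rw [mem_sup_adjoin_iff hF hα hβ hA hB hind] at ht
  obtain ⟨a, b, c, d, ha, hb, hc, hd, rfl⟩ := ht
  have h1 : conj (a + b * α + c * β + d * (α * β)) = a - b * α - c * β + d * (α * β) := by
    rw [map_add, map_add, map_add, map_mul, map_mul, map_mul, map_mul, hF a ha, hF b hb, hF c hc, hF d hd, hα, hβ]
    ring
  rw [h1] at hct
  have h0 : (2 * a) + 0 * α + 0 * β + (2 * d) * (α * β) = 0 := by linear_combination hct
  obtain ⟨h2, -, -, h3⟩ := repr_eq_zero hF hα hβ hB hind (mul_mem (natCast_mem F 2) ha) (zero_mem F) (zero_mem F)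
    (mul_mem (natCast_mem F 2) hd) h0
  refine ⟨b, c, hb, hc, ?_⟩
  have ha0 : a = 0 := by simpa using h2
  have hd0 : d = 0 := by simpa using h3
  rw [ha0, hd0]; ring

/-! ### §3 Squares and subfields through `F` -/

/-- **An anti-real `pα + qβ` with square in `F` has `pq = 0`** (`(pα+qβ)² = p²α² + q²β² + 2pq·αβ`). [folklore] -/
theorem eq_zero_or_eq_zero_of_sq_mem (hA : α * α ∈ F) (hB : β * β ∈ F) (hind : α * β ∉ F) {p q : ℂ} (hp : p ∈ F)
    (hq : q ∈ F) (hsq : (p * α + q * β) * (p * α + q * β) ∈ F) : p = 0 ∨ q = 0 := by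
  by_contra h
  rw [not_or] at h
  apply hind
  have h2 : (2 : ℂ) * p * q ≠ 0 := mul_ne_zero (mul_ne_zero two_ne_zero h.1) h.2
  have : α * β = ((p * α + q * β) * (p * α + q * β) - p * p * (α * α) - q * q * (β * β)) * (2 * p * q)⁻¹ := by
    rw [eq_mul_inv_iff_mul_eq₀ h2]; ring
  rw [this]
  exact mul_mem (sub_mem (sub_mem hsq (mul_mem (mul_mem hp hp) hA)) (mul_mem (mul_mem hq hq) hB))
    (inv_mem (mul_mem (mul_mem (natCast_mem F 2) hp) hq))

/-- **A subfield `M ⊇ F` containing `pα + qβ` with `pq ≠ 0` contains `α` and `β`**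
(`s² ⟹ αβ ∈ M`, then `pA·s − q·sαβ = (p²A − q²B)α`). [folklore] -/
theorem mem_of_combination_mem (hA : α * α ∈ F) (hB : β * β ∈ F) (hind : α * β ∉ F) {M : IntermediateField ℚ ℂ}
    (hFM : F ≤ M) {p q : ℂ} (hp : p ∈ F) (hq : q ∈ F) (hp0 : p ≠ 0) (hq0 : q ≠ 0) (hs : p * α + q * β ∈ M) :
    α ∈ M ∧ β ∈ M := by
  have hαβ : α * β ∈ M := by
    have h2 : (2 : ℂ) * p * q ≠ 0 := mul_ne_zero (mul_ne_zero two_ne_zero hp0) hq0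
    have : α * β = ((p * α + q * β) * (p * α + q * β) - p * p * (α * α) - q * q * (β * β)) * (2 * p * q)⁻¹ := by
      rw [eq_mul_inv_iff_mul_eq₀ h2]; ring
    rw [this]
    exact mul_mem (sub_mem (sub_mem (mul_mem hs hs) (hFM (mul_mem (mul_mem hp hp) hA)))
      (hFM (mul_mem (mul_mem hq hq) hB))) (inv_mem (hFM (mul_mem (mul_mem (natCast_mem F 2) hp) hq)))
  have hD : p * p * (α * α) - q * q * (β * β) ≠ 0 := by
    intro h0
    -- `(pα)² = (qβ)²` ⟹ `pα = ± qβ` ⟹ `αβ ∈ F`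
    have h1 : (p * α - q * β) * (p * α + q * β) = 0 := by linear_combination h0
    rcases mul_eq_zero.1 h1 with h | h
    · apply hind
      have : α * β = q * (β * β) * p⁻¹ := by rw [eq_mul_inv_iff_mul_eq₀ hp0]; linear_combination β * h
      rw [this]; exact mul_mem (mul_mem hq hB) (inv_mem hp)
    · apply hind
      have : α * β = -q * (β * β) * p⁻¹ := by rw [eq_mul_inv_iff_mul_eq₀ hp0]; linear_combination β * h
      rw [this]; exact mul_mem (mul_mem (neg_mem hq) hB) (inv_mem hp)
  have hαM : α ∈ M := by
    have : α = (p * (α * α) * (p * α + q * β) - q * ((p * α + q * β) * (α * β))) *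
        (p * p * (α * α) - q * q * (β * β))⁻¹ := by
      rw [eq_mul_inv_iff_mul_eq₀ hD]; ring
    rw [this]
    exact mul_mem (sub_mem (mul_mem (hFM (mul_mem hp hA)) hs) (mul_mem (hFM hq) (mul_mem hs hαβ)))
      (inv_mem (sub_mem (hFM (mul_mem (mul_mem hp hp) hA)) (hFM (mul_mem (mul_mem hq hq) hB))))
  refine ⟨hαM, ?_⟩
  have : β = (p * α + q * β - p * α) * q⁻¹ := by rw [eq_mul_inv_iff_mul_eq₀ hq0]; ring
  rw [this]
  exact mul_mem (sub_mem hs (mul_mem (hFM hp) hαM)) (inv_mem (hFM hq))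

/-- **An anti-real element of `E = F(α, β)` with square in `F` lies on one of the axes `Fα`, `Fβ`.** [folklore] -/
theorem mem_axis_of_sq_mem (hF : ∀ t ∈ F, conj t = t) (hα : conj α = -α) (hβ : conj β = -β) (hA : α * α ∈ F)
    (hB : β * β ∈ F) (hind : α * β ∉ F) {γ : ℂ} (hγ : γ ∈ F ⊔ IntermediateField.adjoin ℚ {α, β})
    (hcγ : conj γ = -γ) (hsq : γ * γ ∈ F) : (∃ f ∈ F, γ = f * α) ∨ ∃ f ∈ F, γ = f * β := by
  obtain ⟨p, q, hp, hq, rfl⟩ := exists_repr_of_conj_eq_neg hF hα hβ hA hB hind hγ hcγ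
  rcases eq_zero_or_eq_zero_of_sq_mem hA hB hind hp hq hsq with h | h
  · exact Or.inr ⟨q, hq, by rw [h]; ring⟩
  · exact Or.inl ⟨p, hp, by rw [h]; ring⟩

/-! ### §4 Two CM biquadratic fields over the same real field meet in a real field, unless a coincidence -/

/-- **`E₀ = F(α, β)` and `E₁ = F(α′, β′)` meet in a field fixed pointwise by conjugation unless one of `α/α′, α/β′,
β/α′, β/β′` lies in `F`.**  Proof: for `t ∈ E₀ ∩ E₁` non-real, `s = t − t̄ = pα + qβ ≠ 0` is anti-real in both; if
`pq ≠ 0` then `α ∈ E₁` (§3), if `q = 0` then `α ∈ E₁`, if `p = 0` then `β ∈ E₁`; an anti-real element of `E₁` with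
square in `F` is on an axis `Fα′` or `Fβ′`. [cite: Lang2002, VI §1] -/
theorem conj_apply_eq_of_mem_of_mem (hF : ∀ t ∈ F, conj t = t) (hα : conj α = -α) (hβ : conj β = -β)
    (hA : α * α ∈ F) (hB : β * β ∈ F) (hind : α * β ∉ F) {α' β' : ℂ} (hα' : conj α' = -α') (hβ' : conj β' = -β')
    (hA' : α' * α' ∈ F) (hB' : β' * β' ∈ F) (hind' : α' * β' ∉ F) (h₁ : ∀ f ∈ F, α ≠ f * α')
    (h₂ : ∀ f ∈ F, α ≠ f * β') (h₃ : ∀ f ∈ F, β ≠ f * α') (h₄ : ∀ f ∈ F, β ≠ f * β') (t : ℂ)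
    (ht₀ : t ∈ F ⊔ IntermediateField.adjoin ℚ {α, β}) (ht₁ : t ∈ F ⊔ IntermediateField.adjoin ℚ {α', β'}) :
    conj t = t := by
  by_contra hne
  -- the anti-real part `s = t − t̄`
  set s : ℂ := t - conj t with hs
  have hs0 : s ≠ 0 := fun h => hne (sub_eq_zero.1 h).symm
  have hcs : conj s = -s := by rw [hs, map_sub, Complex.conj_conj]; ring
  have hs₀ : s ∈ F ⊔ IntermediateField.adjoin ℚ {α, β} := sub_mem ht₀ (conj_mem_sup_adjoin hF hα hβ hA hB hind ht₀)
  have hs₁ : s ∈ F ⊔ IntermediateField.adjoin ℚ {α', β'} :=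
    sub_mem ht₁ (conj_mem_sup_adjoin hF hα' hβ' hA' hB' hind' ht₁)
  -- axes of `E₁`
  have haxis : ∀ γ : ℂ, γ ∈ F ⊔ IntermediateField.adjoin ℚ {α', β'} → conj γ = -γ → γ * γ ∈ F →
      (∀ f ∈ F, γ ≠ f * α') → (∀ f ∈ F, γ ≠ f * β') → False := by
    intro γ hγ hcγ hsq hn₁ hn₂
    rcases mem_axis_of_sq_mem hF hα' hβ' hA' hB' hind' hγ hcγ hsq with ⟨f, hf, h⟩ | ⟨f, hf, h⟩
    · exact hn₁ f hf h
    · exact hn₂ f hf h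
  obtain ⟨p, q, hp, hq, hspq⟩ := exists_repr_of_conj_eq_neg hF hα hβ hA hB hind hs₀ hcs
  have hF₁ : F ≤ F ⊔ IntermediateField.adjoin ℚ {α', β'} := le_sup_left
  by_cases hp0 : p = 0
  · -- `s = qβ`, `q ≠ 0`: `β ∈ E₁`
    have hq0 : q ≠ 0 := by rintro rfl; apply hs0; rw [hspq, hp0]; ring
    have hβ₁ : β ∈ F ⊔ IntermediateField.adjoin ℚ {α', β'} := by
      have : β = s * q⁻¹ := by rw [eq_mul_inv_iff_mul_eq₀ hq0, hspq, hp0]; ring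
      rw [this]; exact mul_mem hs₁ (hF₁ (inv_mem hq))
    exact haxis β hβ₁ hβ hB h₃ h₄
  · by_cases hq0 : q = 0
    · have hα₁ : α ∈ F ⊔ IntermediateField.adjoin ℚ {α', β'} := by
        have : α = s * p⁻¹ := by rw [eq_mul_inv_iff_mul_eq₀ hp0, hspq, hq0]; ring
        rw [this]; exact mul_mem hs₁ (hF₁ (inv_mem hp))
      exact haxis α hα₁ hα hA h₁ h₂
    · have hα₁ : α ∈ F ⊔ IntermediateField.adjoin ℚ {α', β'} :=
        (mem_of_combination_mem hA hB hind hF₁ hp hq hp0 hq0 (hspq ▸ hs₁)).1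
      exact haxis α hα₁ hα hA h₁ h₂

/-- Symmetric packaging: the **intersection `E₀ ⊓ E₁` is fixed pointwise by conjugation**. [cite: Lang2002, VI §1] -/
theorem conj_apply_eq_of_mem_inf (hF : ∀ t ∈ F, conj t = t) (hα : conj α = -α) (hβ : conj β = -β)
    (hA : α * α ∈ F) (hB : β * β ∈ F) (hind : α * β ∉ F) {α' β' : ℂ} (hα' : conj α' = -α') (hβ' : conj β' = -β')
    (hA' : α' * α' ∈ F) (hB' : β' * β' ∈ F) (hind' : α' * β' ∉ F) (h₁ : ∀ f ∈ F, α ≠ f * α')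
    (h₂ : ∀ f ∈ F, α ≠ f * β') (h₃ : ∀ f ∈ F, β ≠ f * α') (h₄ : ∀ f ∈ F, β ≠ f * β') {t : ℂ}
    (ht : t ∈ (F ⊔ IntermediateField.adjoin ℚ {α, β}) ⊓ (F ⊔ IntermediateField.adjoin ℚ {α', β'})) :
    conj t = t :=
  conj_apply_eq_of_mem_of_mem hF hα hβ hA hB hind hα' hβ' hA' hB' hind' h₁ h₂ h₃ h₄ t
    (IntermediateField.mem_inf.1 ht).1 (IntermediateField.mem_inf.1 ht).2

/-! ### §5 Finiteness -/

/-- `α` with `α² ∈ F`, `F` finite over `ℚ`, is integral over `ℚ`. [folklore] -/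
theorem isIntegral_of_sq_mem [FiniteDimensional ℚ F] (hA : α * α ∈ F) : IsIntegral ℚ α := by
  have h1 : IsIntegral ℚ (⟨α * α, hA⟩ : F) := Algebra.IsIntegral.isIntegral _
  have h2 : IsIntegral ℚ (α * α) := by
    have := h1.map (IntermediateField.val F)
    simpa using this
  have h3 : IsIntegral ℚ (α ^ 2) := by rw [pow_two]; exact h2
  exact IsIntegral.of_pow two_pos h3

/-- **`E = F ⊔ ℚ⟮α, β⟯` is finite over `ℚ`** when `F` is. [folklore] -/
theorem finiteDimensional_sup_adjoin [FiniteDimensional ℚ F] (hA : α * α ∈ F) (hB : β * β ∈ F) :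
    FiniteDimensional ℚ (F ⊔ IntermediateField.adjoin ℚ {α, β} : IntermediateField ℚ ℂ) := by
  haveI : FiniteDimensional ℚ (IntermediateField.adjoin ℚ ({α, β} : Set ℂ)) := by
    refine IntermediateField.finiteDimensional_adjoin fun x hx => ?_
    rcases hx with rfl | rfl
    · exact isIntegral_of_sq_mem hA
    · exact isIntegral_of_sq_mem hB
  exact IntermediateField.finiteDimensional_sup F _

end Summit.HodgeConjecture.CorCM.CMBiquad

end
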